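import Summits.AtomisticToContinuum.HydrodynamicLimit.Theses.ImplosionDichotomy
import Summits.AtomisticToContinuum.HydrodynamicLimit.Theorems.ImplosionDichotomyHydroLimitInBandEquilibrium
import HarnessLib

/-!
# `HydroLimitInBand` (crux stmt-AtomisticToContinuum-9133), negative side: THE SHEAR REDUCTION

Standing disprover's lemmas (`Cruxes/HydroLimitInBand/Disproof.lean` §7, refuter-cdisprove-stmt-AtomisticToContinuum-9133-0).

* `isHardSphereEulerSolution_shear` — the isothermal parallel shear flow `ρ ≡ 1`, `θ ≡ 1`, `u(x) = sin(2π x₁) e₀` is a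
  CLASSICAL hard-sphere Euler solution for EVERY reduced density `σ` and every `T` (stationary; all fields depend on `x₁`
  only, transport is along `e₀`, the pressure `Z(σ³)` is constant in space). First non-constant member of the solution
  class `IsHardSphereEulerSolution` in the tree.
* `shear_tied` — below the statics threshold it is ADMISSIBLE: tied at `t = 0` to the local Gibbs laws of the profiles
  `(1, sin(2π x₁) e₀, 1)` through every flow family (data pinning, `rhoLim ≡ 1` at constant activity). Hence the
  hypotheses of the crux are simultaneously satisfiable by a non-constant solution on every `[0, T)`: the crux is
  NON-VACUOUS beyond the settled equilibrium case.
* `ShearHydroLimit`, `shearHydroLimit_of_hydroLimitInBand` — the crux implies the law of large numbers along the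
  stationary shear at every `t ≥ 0` and every small `σ` ("Maxwell shear-stress relaxation of deterministic spheres");
  contrapositively `¬ ShearHydroLimit → ¬ HydroLimitInBand`: the cheapest concrete, MD-testable falsifier of the crux.
-/

noncomputable section

open MeasureTheory Filter Set Topology Function
open scoped ContDiff

namespace Summit.AtomisticToContinuum.HydrodynamicLimit.Theorems.HydroLimitInBandNegative

open Literature.MathematicalPhysics.KineticTheory Literature.Analysis.FluidPDE
open Literature.Analysis.FunctionSpaces
open Summit.AtomisticToContinuum.HydrodynamicLimit.Theses.ImplosionDichotomy (HydroLimitInBand)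
open PolynomialCompressionPDE (Flows admissible_iff_data)

/-- `y ↦ sin (2π y)` is `1`-periodic. [folklore] -/
theorem periodic_sin_two_pi_mul : Periodic (fun y : ℝ => Real.sin (2 * Real.pi * y)) 1 := by
  intro y
  simp only [mul_add, mul_one]
  exact Real.sin_add_two_pi _

/-- The profile `sin (2π ·)` on the unit circle. [folklore] -/
def sinCircle : UnitAddCircle → ℝ := periodic_sin_two_pi_mul.lift

/-- Auxiliary (`sinCircle_coe`). [folklore] -/
@[simp] theorem sinCircle_coe (y : ℝ) : sinCircle ((y : ℝ) : UnitAddCircle) = Real.sin (2 * Real.pi * y) :=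
  periodic_sin_two_pi_mul.lift_coe y

/-- The unit vector `e₀` of `ℝ³`. -/
def e0 : V3 := EuclideanSpace.single 0 1

/-- Auxiliary (`e0_apply`). [folklore] -/
@[simp] theorem e0_apply (i : Fin 3) : e0 i = if i = 0 then 1 else 0 := by
  simp [e0]

/-- The shear profile `x ↦ sin (2π x₁)` on `𝕋³` (depends on the coordinate `1` only). [folklore] -/
def shearProfile (x : T3) : ℝ := sinCircle (x 1)

/-- The shear velocity field `u(x) = sin(2π x₁) e₀`. [folklore] -/
def shearVelocity (x : T3) : V3 := shearProfile x • e0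

/-- Auxiliary (`shearVelocity_apply`). [folklore] -/
@[simp] theorem shearVelocity_apply (x : T3) (i : Fin 3) :
    shearVelocity x i = if i = 0 then shearProfile x else 0 := by
  simp [shearVelocity]

/-- Translating along `eᵢ`, `i ≠ 1`, does not change the coordinate `1`. [folklore] -/
theorem coord_one_translate (x : T3) (s : ℝ) {i : Fin 3} (hi : i ≠ 1) :
    (x + Torus.proj (s • EuclideanSpace.single i (1 : ℝ))) 1 = x 1 := by
  rw [Pi.add_apply, Torus.proj_apply]
  simp [hi.symm]

/-- A field depending on the coordinate `1` only has vanishing partial derivatives along `e₀` and `e₂`.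
[folklore] -/
theorem partialDeriv_eq_zero_of_dep {F : Type*} [NormedAddCommGroup F] [NormedSpace ℝ F]
    (G : UnitAddCircle → F) {i : Fin 3} (hi : i ≠ 1) (x : T3) :
    Torus.partialDeriv i (fun y : T3 => G (y 1)) x = 0 := by
  unfold Torus.partialDeriv Torus.lineDeriv
  simp_rw [coord_one_translate x _ hi]
  exact deriv_const 0 _

/-- The lift of the shear velocity to `ℝ × ℝ³` (time × space). -/
theorem stLift_shearVelocity :
    Torus.stLift (fun (_ : ℝ) (x : T3) => shearVelocity x) =
      fun p : ℝ × EuclideanSpace ℝ (Fin 3) => Real.sin (2 * Real.pi * p.2 1) • e0 := by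
  funext p
  simp [Torus.stLift, shearVelocity, shearProfile, Torus.proj_apply]

/-- The shear velocity is jointly smooth (it does not depend on time). [folklore] -/
theorem isSmoothSpaceTimeOn_shearVelocity (S : Set ℝ) :
    Torus.IsSmoothSpaceTimeOn S (fun (_ : ℝ) (x : T3) => shearVelocity x) := by
  unfold Torus.IsSmoothSpaceTimeOn
  rw [stLift_shearVelocity]
  refine ContDiff.contDiffOn ?_
  have h1 : ContDiff ℝ ∞ (fun p : ℝ × EuclideanSpace ℝ (Fin 3) => p.2 1) := by
    fun_prop
  have h2 : ContDiff ℝ ∞ (fun p : ℝ × EuclideanSpace ℝ (Fin 3) => Real.sin (2 * Real.pi * p.2 1)) :=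
    (contDiff_const.mul h1).sin
  have h3 : ContDiff ℝ ∞ (fun _ : ℝ × EuclideanSpace ℝ (Fin 3) => e0) := contDiff_const
  exact h2.smul h3

/-- **The isothermal parallel shear flow is a classical solution**, for every `σ` and `T`: `ρ ≡ 1`, `θ ≡ 1`,
`u = sin(2π x₁) e₀`. All fields depend on `x₁` only and the transport is along `e₀`, so every term of the three
balance laws vanishes; the pressure `Z(σ³)` is constant. [folklore] -/
theorem isHardSphereEulerSolution_shear (σ T : ℝ) :
    IsHardSphereEulerSolution σ T (fun _ _ => 1) (fun _ x => shearVelocity x) (fun _ _ => 1) where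
  smooth_density := contDiffOn_const
  smooth_velocity := isSmoothSpaceTimeOn_shearVelocity _
  smooth_temperature := contDiffOn_const
  density_pos _ _ _ := one_pos
  temperature_pos _ _ _ := one_pos
  mass t _ x := by
    have h0 : Torus.timeDerivWithin (Ico 0 T) (fun (_ : ℝ) (_ : T3) => (1 : ℝ)) t x = 0 := by
      simp [Torus.timeDerivWithin]
    rw [h0, zero_add, Torus.divergence, Fin.sum_univ_three]
    have e1 : (fun y : T3 => ((1 : ℝ) • shearVelocity y) 0) = fun y => sinCircle (y 1) := by
      funext y; simp [shearProfile]
    have e2 : (fun y : T3 => ((1 : ℝ) • shearVelocity y) 1) = fun _ => (0 : ℝ) := by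
      funext y; simp
    have e3 : (fun y : T3 => ((1 : ℝ) • shearVelocity y) 2) = fun _ => (0 : ℝ) := by
      funext y; simp
    rw [e1, e2, e3, partialDeriv_eq_zero_of_dep _ (by decide)]
    simp [Torus.partialDeriv, Torus.lineDeriv]
  momentum t _ x := by
    have h0 : Torus.timeDerivWithin (Ico 0 T) (fun (_ : ℝ) (y : T3) => (1 : ℝ) • shearVelocity y) t x = 0 := by
      simp [Torus.timeDerivWithin]
    have hp : Torus.gradient (fun _ : T3 => hsPressure σ 1 1) x = 0 := by
      unfold Torus.gradient Torus.liftAt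
      exact gradient_fun_const 0 _
    rw [h0, zero_add, hp, add_zero, Fin.sum_univ_three]
    have e1 : (fun y : T3 => ((1 : ℝ) * shearVelocity y 0) • shearVelocity y) =
        fun y => (sinCircle (y 1)) • ((sinCircle (y 1)) • e0) := by
      funext y; simp [shearVelocity, shearProfile]
    have e2 : (fun y : T3 => ((1 : ℝ) * shearVelocity y 1) • shearVelocity y) = fun _ => (0 : V3) := by
      funext y; simp
    have e3 : (fun y : T3 => ((1 : ℝ) * shearVelocity y 2) • shearVelocity y) = fun _ => (0 : V3) := by
      funext y; simp
    rw [e1, e2, e3, partialDeriv_eq_zero_of_dep (fun c => sinCircle c • (sinCircle c • e0)) (by decide)]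
    simp [Torus.partialDeriv, Torus.lineDeriv]
  energy t _ x := by
    have h0 : Torus.timeDerivWithin (Ico 0 T)
        (fun (_ : ℝ) (y : T3) => totalEnergyDensity 1 (shearVelocity y) 1) t x = 0 := by
      simp [Torus.timeDerivWithin]
    rw [h0, zero_add, Torus.divergence, Fin.sum_univ_three]
    have e1 : (fun y : T3 => ((totalEnergyDensity 1 (shearVelocity y) 1 + hsPressure σ 1 1) • shearVelocity y) 0) =
        fun y => (totalEnergyDensity 1 (sinCircle (y 1) • e0) 1 + hsPressure σ 1 1) * sinCircle (y 1) := by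
      funext y; simp [shearVelocity, shearProfile]
    have e2 : (fun y : T3 => ((totalEnergyDensity 1 (shearVelocity y) 1 + hsPressure σ 1 1) • shearVelocity y) 1) =
        fun _ => (0 : ℝ) := by
      funext y; simp
    have e3 : (fun y : T3 => ((totalEnergyDensity 1 (shearVelocity y) 1 + hsPressure σ 1 1) • shearVelocity y) 2) =
        fun _ => (0 : ℝ) := by
      funext y; simp
    rw [e1, e2, e3,
      partialDeriv_eq_zero_of_dep (fun c => (totalEnergyDensity 1 (sinCircle c • e0) 1 + hsPressure σ 1 1) * sinCircle c)
        (by decide)]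
    simp [Torus.partialDeriv, Torus.lineDeriv]

/-- The shear velocity is continuous. [folklore] -/
theorem continuous_shearVelocity : Continuous shearVelocity :=
  ((isSmoothSpaceTimeOn_shearVelocity univ).isSmooth_slice (mem_univ (0 : ℝ))).continuous

/-- **The shear flow is ADMISSIBLE**: for the profiles `(a₀, u₀, θ₀) = (1, sin(2π x₁) e₀, 1)` and every `σ`
below the statics threshold, the stationary shear solution is tied at `t = 0` to the local Gibbs laws through
every flow family (data pinning: `rhoLim` of a constant activity is `1`). So the hypotheses of the crux
`HydroLimitInBand` are simultaneously satisfiable by a NON-constant classical solution on every `[0, T)`: the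
crux is non-vacuous beyond equilibrium. [folklore] -/
theorem shear_tied :
    ∃ σ₁ : ℝ, 0 < σ₁ ∧ σ₁ ≤ 1 / 2 ∧ ∀ σ : ℝ, 0 < σ → σ < σ₁ → ∀ Φ : Flows σ,
      TendstoHydroFieldsAt (fun N => localGibbsLaw σ (fun _ => 1) shearVelocity (fun _ => 1) N (Φ N)) Φ
        (fun _ _ => 1) (fun _ x => shearVelocity x) (fun _ _ => 1) 0 := by
  obtain ⟨σ₁, hσ₁, hσ₁2, A⟩ := admissible_iff_data (a₀ := fun _ => (1 : ℝ)) (θ₀ := fun _ => (1 : ℝ))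
    (u₀ := shearVelocity) continuous_const continuous_const continuous_shearVelocity (fun _ => one_pos)
    (fun _ => one_pos)
  refine ⟨σ₁, hσ₁, hσ₁2, fun σ hσ hσlt Φ => ?_⟩
  obtain ⟨hsd, A'⟩ := A σ hσ hσlt
  refine (A' (fun _ _ => 1) (fun _ _ => 1) (fun _ x => shearVelocity x) continuous_const
    continuous_shearVelocity continuous_const).2 ⟨?_, rfl, rfl⟩ Φ
  rw [HydroLimitInBandEquilibrium.rhoLim_constActivity_eq_one one_pos hsd]

/-- **The simplest non-equilibrium consequence of the crux** ("Maxwell shear-stress relaxation of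
deterministic spheres"): at every small reduced density, under the local Gibbs laws of the shear profile, the
empirical fields follow the STATIONARY shear flow at every time `t ≥ 0`. -/
def ShearHydroLimit : Prop :=
  ∃ σ₀ : ℝ, 0 < σ₀ ∧ ∀ σ : ℝ, 0 < σ → σ < σ₀ → ∀ Φ : Flows σ, ∀ t : ℝ, 0 ≤ t →
    TendstoHydroFieldsAt (fun N => localGibbsLaw σ (fun _ => 1) shearVelocity (fun _ => 1) N (Φ N)) Φ
      (fun _ _ => 1) (fun _ x => shearVelocity x) (fun _ _ => 1) t

/-- **`HydroLimitInBand → ShearHydroLimit`**: the crux implies the LLN along the stationary shear flow at every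
time (the shear solution exists on every `[0, T)`, is admissible, and has packing `σ³ < η₀` for small `σ`).
Contrapositively, a failure of the shear LLN at ONE time for arbitrarily small `σ` refutes the crux — the
cheapest concrete falsifier of `HydroLimitInBand` (MD-testable). [folklore] -/
theorem shearHydroLimit_of_hydroLimitInBand (h : HydroLimitInBand) : ShearHydroLimit := by
  obtain ⟨η₀, hη₀, H⟩ := h
  obtain ⟨σ₀, hσ₀, G⟩ := H (fun _ => 1) (fun _ => 1) shearVelocity continuous_const continuous_const
    continuous_shearVelocity (fun _ => one_pos) (fun _ => one_pos)
  obtain ⟨σ₁, hσ₁, -, S⟩ := shear_tied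
  refine ⟨min σ₀ (min σ₁ (min 1 (η₀ / 2))),
    lt_min hσ₀ (lt_min hσ₁ (lt_min one_pos (by positivity))), fun σ hσ hσlt Φ t ht => ?_⟩
  have hσ₀' : σ < σ₀ := lt_of_lt_of_le hσlt (min_le_left _ _)
  have hσ₁' : σ < σ₁ := lt_of_lt_of_le hσlt ((min_le_right _ _).trans (min_le_left _ _))
  have hσ1 : σ < 1 := lt_of_lt_of_le hσlt ((min_le_right _ _).trans ((min_le_right _ _).trans (min_le_left _ _)))
  have hση : σ < η₀ / 2 :=
    lt_of_lt_of_le hσlt ((min_le_right _ _).trans ((min_le_right _ _).trans (min_le_right _ _)))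
  have hcube : σ ^ 3 ≤ σ := by
    have := pow_le_pow_of_le_one hσ.le hσ1.le (show 1 ≤ 3 by norm_num)
    simpa using this
  have hguard : ∀ s ∈ Ico (0 : ℝ) (t + 1), ∀ x : T3, (1 : ℝ) * σ ^ 3 < η₀ := by
    intro s _ x; linarith
  exact G σ hσ hσ₀' (t + 1) _ _ _ (isHardSphereEulerSolution_shear σ (t + 1)) hguard Φ (S σ hσ hσ₁' Φ) t
    ⟨ht, by linarith⟩

end Summit.AtomisticToContinuum.HydrodynamicLimit.Theorems.HydroLimitInBandNegative

end
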